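import Summits.AtomisticToContinuum.HydrodynamicLimit.Theorems.CollisionIsometryCLTCollisionalTransferLocalityRhsSupOfConstLLN
import Summits.AtomisticToContinuum.HydrodynamicLimit.Theorems.CollisionIsometryCLTCollisionalTransferLocalityBlockDensityLLNConst
import Summits.AtomisticToContinuum.HydrodynamicLimit.Theorems.CollisionIsometryCLTCollisionalTransferLocalityBlockVelocityLLNConst
import Summits.AtomisticToContinuum.HydrodynamicLimit.Theorems.CollisionIsometryCLTCollisionalTransferLocalityConstLLNOfParts
import Summits.AtomisticToContinuum.HydrodynamicLimit.Theorems.CollisionIsometryCLTCollisionalTransferLocalityWeightedKineticRelaxationDilute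
import Summits.AtomisticToContinuum.HydrodynamicLimit.Theorems.CollisionIsometryCLTCollisionalTransferLocalityCompressibilityLinear
import Summits.AtomisticToContinuum.HydrodynamicLimit.Theorems.CollisionIsometryCLTCollisionalTransferLocalityEnergyAllTimes
import Summits.AtomisticToContinuum.HydrodynamicLimit.Theorems.CollisionIsometryCLTCollisionalTransferLocalityCeilingAllTimesRung0
import Summits.AtomisticToContinuum.HydrodynamicLimit.Theorems.CollisionIsometryCLTCollisionalTransferLocalityFmrRung0
import HarnessLib

/-!
# [Vχ0M] The energy value functional on MESOSCALE block fields vanishes at global equilibrium,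
# uniformly in `τ ≤ t` (stub `stub_valueChi_meso_const`, line `hemisphere-affine-slaving`,
# crux `CollisionalTransferLocality`, stmt-AtomisticToContinuum-9518)

Supporting file (`--supports stmt-AtomisticToContinuum-9518`) proving the registered stub [Vχ0M] VERBATIM: for
`θ > 0` there is `σ₀ > 0` such that for `0 < σ < σ₀`, every flow family `Φ`, `t > 0`, every admissible kernel
family `φ` (`0 < γ ≤ 1/15`), a scalar test `χ` smooth on `[0, t]` and `δ > 0`, under
`G_N = localGibbsLaw σ 1 0 θ N (Φ N)`:
`G_N {∃ τ ∈ [0, t], δ < |Rhs[φ](0, χ)(τ) + Kfun[φ](0, χ)(τ)|} → 0`.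

Proof: an ASSEMBLY of landed theorems, by a union bound at level `δ/2` (same `τ`, `|a + b| ≤ |a| + |b|`):
* `sup_τ |Rhs| → 0`: the landed [R0] `stub_rhsSup_of_constLLN` (…RhsSupOfConstLLN) fed with the
  constant-profile block LLN package (composition 4 of the skeleton, re-derived inline from the landed
  `stub_blockDensityLLNConst`, `stub_blockVelocityLLNConst`, `stub_constLLN_of_parts` and
  `isProbabilityMeasure_localGibbsLaw`), at the zero vector test `ψ₀ = 0` (smooth: `isSmoothSpaceTimeOn_const`);
* `sup_τ |Kfun| → 0` (`RelaxC`): the landed [C]° `stub_weightedKineticRelaxationDilute` fed with the [Z]-constants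
  of `stub_hsCompressibility_linear` (dilute level `η₁ := η_Z`), the energy cap of [E] `stub_energyAllTimes` at the
  nice constant profiles `(1, θ, 0)` (`σ ≤ 1/2`), the dilute ceiling `ceilingAllTimes_const` (…CeilingAllTimesRung0,
  threshold `σ_S`) and the kinetic closure at equilibrium `fmr_rung0` (…FmrRung0, `σ ≤ 1/2`);
* `σ₀ := min σ_R (min σ_S (1/2))`.
Folklore; no definitions, no named facts.
-/

namespace Summit.AtomisticToContinuum.HydrodynamicLimit.Theorems.HemisphereAffineSlaving

open scoped BigOperators Topology Classical ENNReal InnerProductSpace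
open Filter Set Function MeasureTheory

noncomputable section

open Literature.MathematicalPhysics.KineticTheory (T3 V3)
open Literature.Analysis.FunctionSpaces
open Literature.MathematicalPhysics.KineticTheory (localGibbsLaw isProbabilityMeasure_localGibbsLaw)

/-! ## The registered stub -/

/-- **[Vχ0M] Registered stub `stub_valueChi_meso_const` (line `hemisphere-affine-slaving`, crux
`CollisionalTransferLocality`, stmt-AtomisticToContinuum-9518): THE ENERGY VALUE FUNCTIONAL ON MESOSCALE BLOCK
FIELDS VANISHES AT GLOBAL EQUILIBRIUM, UNIFORMLY IN `τ ≤ t`.** Under the homogeneous local Gibbs law `(1, 0, θ)`,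
for `σ < σ₀(θ) = min σ_R (min σ_S (1/2))`, every flow family, `t > 0`, admissible kernel family `φ` and scalar
test `χ` smooth on `[0, t]`: `G_N {∃ τ ∈ [0, t], δ < |Rhs[φ](0, χ)(τ) + Kfun[φ](0, χ)(τ)|} → 0`
(`sup_τ |Rhs| → 0` by [R0] `stub_rhsSup_of_constLLN` at the constant-profile block LLN; `sup_τ |Kfun| → 0` is
`RelaxC` from [C]° `stub_weightedKineticRelaxationDilute` with [Z], [E], the equilibrium ceiling and `fmr_rung0`;
union bound at `δ/2`). [folklore] -/
theorem stub_valueChi_meso_const : ∀ θ : ℝ, 0 < θ → ∃ σ₀ : ℝ, 0 < σ₀ ∧ ∀ σ : ℝ, 0 < σ → σ < σ₀ → ∀ (Φ : Flows σ) (t : ℝ), 0 < t → ∀ (γ C : ℝ) (φ : ℕ → T3 → ℝ), 0 < γ → γ ≤ 1 / 15 → AdmissibleKernel γ C φ → ∀ (χ : ℝ → T3 → ℝ), Literature.Analysis.FunctionSpaces.Torus.IsSmoothSpaceTimeOn (Icc 0 t) χ → ∀ δ : ℝ, 0 < δ → Tendsto (fun N : ℕ => Literature.MathematicalPhysics.KineticTheory.localGibbsLaw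 σ (fun _ => 1) (fun _ => 0) (fun _ => θ) N (Φ N) {z | ∃ τ ∈ Icc 0 t, δ < |(Rhs σ Φ φ (fun (_ : ℝ) (_ : T3) => (0 : V3)) χ N z τ + Kfun σ Φ φ (fun (_ : ℝ) (_ : T3) => (0 : V3)) χ N z τ)|}) atTop (𝓝 0) := by
  intro θ hθ
  /- (a) the constant-profile block LLN package with identified limit (composition 4 of the skeleton, from the
  landed [CL-ρ], [CL-v], [CL-asm]; mass one from `isProbabilityMeasure_localGibbsLaw`, `σ ≤ 1/2`) -/
  have hLLN : ∀ θ : ℝ, 0 < θ → ∃ σ₀ : ℝ, 0 < σ₀ ∧ ∀ σ : ℝ, 0 < σ → σ < σ₀ → ∀ Φ : Flows σ,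
      (∀ N, IsProbabilityMeasure (localGibbsLaw σ (fun _ => 1) (fun _ => 0) (fun _ => θ) N (Φ N))) ∧
      ∀ (γ C : ℝ) (φ : ℕ → T3 → ℝ), 0 < γ → γ ≤ 1 / 15 → AdmissibleKernel γ C φ → ∀ δ : ℝ, 0 < δ →
        Tendsto (fun N : ℕ => localGibbsLaw σ (fun _ => 1) (fun _ => 0) (fun _ => θ) N (Φ N)
          {z | δ < ∫ x, ((rhoB φ N z x - 1) ^ 2 + ‖mB φ N z x‖ ^ 2 + (EB φ N z x - 3 / 2 * θ) ^ 2)})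
          atTop (𝓝 0) := by
    obtain ⟨σρ, hσρ, Hρ⟩ := stub_blockDensityLLNConst
    intro θ' hθ'
    refine ⟨min σρ (1 / 2), lt_min hσρ one_half_pos, fun σ hσ hlt Φ => ?_⟩
    have hltρ : σ < σρ := lt_of_lt_of_le hlt (min_le_left _ _)
    have hhalf : σ ≤ 1 / 2 := (lt_of_lt_of_le hlt (min_le_right _ _)).le
    refine ⟨fun N => isProbabilityMeasure_localGibbsLaw continuous_const continuous_const continuous_const
        (fun _ => one_pos) (fun _ => hθ') hhalf N (Φ N), fun γ C φ hγ hγ' hadm δ hδ => ?_⟩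
    have hφc : ∀ N, Continuous (φ N) := fun N => (hadm.1 N).continuous
    exact stub_constLLN_of_parts σ θ' Φ φ hφc
      (fun δ' hδ' => Hρ σ hσ hltρ θ' hθ' Φ γ C φ hγ hγ' hadm δ' hδ')
      (fun δ' hδ' => stub_blockVelocityLLNConst σ hσ hhalf θ' hθ' Φ γ C φ hγ hγ' hadm δ' hδ') δ hδ
  -- the three thresholds: [R0] at the LLN package, the dilute ceiling at level `η_Z` of [Z], `1/2`
  obtain ⟨σR, hσR, HR⟩ := stub_rhsSup_of_constLLN hLLN θ hθ
  obtain ⟨ηZ, hηZ, K, hK0, hZK⟩ := stub_hsCompressibility_linear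
  obtain ⟨σS, hσS, HS⟩ := ceilingAllTimes_const ηZ hηZ θ hθ
  refine ⟨min σR (min σS (1 / 2)), lt_min hσR (lt_min hσS one_half_pos), ?_⟩
  intro σ hσ hσlt Φ t ht γ C φ hγ hγ' hadm χ hχ δ hδ
  have hσR' : σ < σR := lt_of_lt_of_le hσlt (min_le_left _ _)
  have hσS' : σ < σS := lt_of_lt_of_le hσlt ((min_le_right _ _).trans (min_le_left _ _))
  have hσ2 : σ ≤ 1 / 2 := (lt_of_lt_of_le hσlt ((min_le_right _ _).trans (min_le_right _ _))).le
  -- the zero vector test is smooth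
  set ψ₀ : ℝ → T3 → V3 := fun (_ : ℝ) (_ : T3) => (0 : V3) with hψ₀def
  have hψ₀ : Torus.IsSmoothSpaceTimeOn (Icc 0 t) ψ₀ := Torus.isSmoothSpaceTimeOn_const (Torus.isSmooth_const _) _
  -- (a) the Rhs part at level `δ/2`
  have hRhs := HR σ hσ hσR' Φ t ht γ C φ hγ hγ' hadm ψ₀ χ hψ₀ hχ (δ / 2) (half_pos hδ)
  -- (b) the Kfun part: `RelaxC` from [C]° with [Z], [E] at the nice profiles `(1, θ, 0)`, the ceiling, `fmr_rung0`
  have hP : NiceProfiles (fun _ : T3 => (1 : ℝ)) (fun _ => θ) (fun _ => (0 : V3)) :=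
    ⟨continuous_const, continuous_const, continuous_const, fun _ => one_pos, fun _ => hθ⟩
  obtain ⟨E₀, -, hEner⟩ := stub_energyAllTimes (fun _ => 1) (fun _ => θ) (fun _ => 0) hP σ hσ hσ2 Φ
  have hDil : DiluteAt σ (fun _ => 1) (fun _ => θ) (fun _ => 0) Φ t φ ηZ :=
    HS σ hσ hσS' Φ t ht γ C φ hγ hγ' hadm
  have hFloc := fmr_rung0 σ hσ hσ2 θ hθ Φ γ C φ hγ hγ' hadm t ht
  have hC : RelaxC σ (fun _ => 1) (fun _ => θ) (fun _ => 0) Φ φ t ψ₀ χ :=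
    stub_weightedKineticRelaxationDilute ηZ K hηZ hK0 hZK ηZ hηZ le_rfl σ hσ (fun _ => 1) (fun _ => θ)
      (fun _ => 0) Φ t E₀ ht (hEner t) γ C φ hγ hγ' hadm hDil hFloc ψ₀ χ hψ₀ hχ
  have hKf := hC (δ / 2) (half_pos hδ)
  -- (c) the union bound at level `δ/2` (same `τ`)
  have hsum := hRhs.add hKf
  rw [add_zero] at hsum
  refine tendsto_of_tendsto_of_tendsto_of_le_of_le tendsto_const_nhds hsum (fun _ => zero_le) fun N => ?_
  refine (measure_mono fun z hz => ?_).trans (measure_union_le _ _)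
  obtain ⟨τ, hτ, hτδ⟩ := hz
  by_contra h
  simp only [mem_union, mem_setOf_eq, not_or, not_exists, not_and, not_lt] at h
  have h1 : |Rhs σ Φ φ ψ₀ χ N z τ| ≤ δ / 2 := h.1 τ hτ
  have h2 : |Kfun σ Φ φ ψ₀ χ N z τ| ≤ δ / 2 := h.2 τ hτ
  have h3 := abs_add_le (Rhs σ Φ φ ψ₀ χ N z τ) (Kfun σ Φ φ ψ₀ χ N z τ)
  linarith [hτδ.trans_le h3]

end

end Summit.AtomisticToContinuum.HydrodynamicLimit.Theorems.HemisphereAffineSlaving
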